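import Literature.MathematicalPhysics.QuantumFieldTheory.Balaban1983to89.B7ConclConcrete
import Literature.MathematicalPhysics.QuantumFieldTheory.Balaban1983to89.DagBinding

/-!
# NODE 00 (YM-PLAN Track A) — the B7 group of the carrier bundle `X : DagBinding.PrintedCarriersR` AT THE CONCRETE
# OBJECTS of [Balaban1985Averaging], assembled from the tree (`B7ConclConcrete`), and what it gives the DAG node N04 (`Dag.B7_main`)

NODE 00 STAGE-1 MODULE (seat `pub-ymgap-node00-def`, YM-PLAN §2a NODE 00; root module of record `Node00Carriers`, whose CONVENTIONS OF RECORD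
block applies here), NOT by itself a discharge booking (node rows are booked by the plan seat and the leads).  HONEST FRAMING: definitions + kernel bookkeeping; the only analytic content is the lit-balaban theorem
`B7ConclConcrete.concl_concrete` (Props. 1–10 of [Balaban1985Averaging] for the concrete `ℤᵈ` carriers, `G = U(𝔸)`), cited by name.
Nothing of the series' end statement, no continuum / mass-gap claim.

WHAT THIS FILE SHOWS (for the scoping report NODE00-SCOPING.md §3 F2):
* `Node00.withB7OfRecord X d L 𝔸` — the carrier bundle `X` with its WHOLE B7 group (index types `I7a…I7e`, families
  `one7 kst7 kexp7 gd7 gone7`, constants `L7 c₂ C₀ c₂'`) replaced by the concrete objects of the lit-balaban B7 lineage: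
  `B7ConclOneStep.concreteOneStepBD` (one-step average (42), genuine Prop. 3 fields), `B7Prop2Explicit.concreteKStep` (k-fold average
  (43)), `B7ConclKExp.concreteKExp` ((127)/(134)/(156)/(164)), `B7ConclGauge.concreteGaugeData` / `concreteGaugeOneStep` (Sects. E–F),
  constants `c₂ = cB d L = min{1/(3C₀), ½c₂′}`, `C₀ = C0 d`, `c₂′ = c2' d L` — every other group of `X` unchanged;
* `b7_withB7OfRecord` — at these carriers the leaf `b7` of the binding of record `Upstream.ofPrintedAllXP` HOLDS outright (`L ≥ 2`);
* `b7_main_withB7OfRecord` — hence `Dag.B7_main (DagBinding.leavesP w P)` (= the venue's `YMDAG.N04 w P`) for EVERY binding world `w`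
  whose upstream block is `ofPrintedAllXP (withB7OfRecord X d L 𝔸) Y Z V W`, every run `P` (the `b5` antecedent is not used).
LOCATED READINGS inherited from the lineage (NOT adjudicated here; listed for the rulings Q-N00-2/3 of the report): the η-lattice read on `ℤᵈ`
(print: Ω ⊂ ηℤᵈ a union of k-blocks, p. 18); Banach/C⋆ carrier with `U1 𝔸 ⊇ G`-valued configurations and `G = U(𝔸)` (print: G a Lie
subgroup of U(N), p. 18; for `𝔸 = M_N(ℂ)` with the operator norm (19) this is U(N); SU(N)-closure of the averages is a separate located item,
`B7Prop2SpecialUnitary`); corner-anchored blocks of [Balaban1985Averaging] (2) (the 1987 centred prescription of [Balaban1987RG1] (0.3)–(0.4)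
is a DIFFERENT averaging — cell DIVERGENCE F3, t4 ruling Q36/Q45); `≤`/`<` as typed in `B7.lean`; `L ≥ 2` any (print: L odd, > 11 in [Balaban1987RG1]).
-/

noncomputable section

namespace Literature.MathematicalPhysics.QuantumFieldTheory.Balaban1983to89.Node00

open DagBinding B7Prop1Explicit B7Prop2Explicit B7ConclOneStep B7ConclKExp B7ConclGauge B7ConclConcrete

/-- The carrier bundle `X` with its B7 group ([Balaban1985Averaging] Props. 1–10) set to the CONCRETE objects of the lit-balaban B7
lineage on `ℤᵈ` with block size `L`, Banach/C⋆ coefficient algebra `𝔸` (print: `M_N(ℂ)`), gauge group `U(𝔸)`; constants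
`L7 = L`, `c₂ = cB d L`, `C₀ = C0 d`, `c₂' = c2' d L`.  All other groups of `X` (B4, B5, B6, B8, B10, B12, B13, the R-extension) unchanged. [folklore] -/
def withB7OfRecord (X : PrintedCarriersR) (d L : ℕ) (𝔸 : Type) [CStarAlgebra 𝔸] [Nontrivial 𝔸] :
    PrintedCarriersR :=
  { X with
    I7a := Idx d
    I7b := ℕ
    I7c := KIdx d
    I7d := GIdx 𝔸 d L
    I7e := PUnit
    L7 := (L : ℝ)
    c₂ := cB d L
    C₀ := C0 d
    c₂' := c2' d L
    one7 := concreteOneStepBD 𝔸 (d := d) L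
    kst7 := fun k : ℕ => concreteKStep d 𝔸 (unitaryUnits 𝔸) L k
    kexp7 := concreteKExp 𝔸 (unitaryUnits 𝔸) (d := d) L
    gd7 := concreteGaugeData 𝔸 (d := d) L
    gone7 := concreteGaugeOneStep 𝔸 (d := d) L }

/-- **Leaf `b7` HOLDS at the B7 objects of the lineage** (`L ≥ 2`): `B7.Concl` for the substituted carriers is
`B7ConclConcrete.concl_concrete`, by name. [cite: Balaban1985Averaging, Props. 1–10 pp.26–50 (kernel version of the lit-balaban lineage for its concrete ℤᵈ carriers)] -/
theorem b7_withB7OfRecord (X : PrintedCarriersR) (Y : PrintedCarriers9X) (Z : PrintedCarriers11) (V : PrintedCarriers14R)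
    (W : PrintedCarriers15) (d L : ℕ) (hL : 2 ≤ L) (𝔸 : Type) [CStarAlgebra 𝔸] [Nontrivial 𝔸] :
    (Upstream.ofPrintedAllXP (withB7OfRecord X d L 𝔸) Y Z V W).b7 :=
  concl_concrete d L hL 𝔸

/-- **Consequently the DAG node N04 (`Dag.B7_main` = «b5 → b7») holds at EVERY binding world whose upstream block is the binding of
record over carriers with this B7 group**, every run `P` — the antecedent `b5` is not used.  (Venue form: `YMDAG.N04 w P`.)  This is
bookkeeping over the lineage's theorem, recorded for the scoping report; whether these carriers are «the objects of record» is the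
ruling Q-N00-2 asked there, not asserted here. [cite: Balaban1985Averaging, Props. 1–10 pp.26–50 (kernel version of the lit-balaban lineage)] -/
theorem b7_main_withB7OfRecord (X : PrintedCarriersR) (Y : PrintedCarriers9X) (Z : PrintedCarriers11) (V : PrintedCarriers14R)
    (W : PrintedCarriers15) (d L : ℕ) (hL : 2 ≤ L) (𝔸 : Type) [CStarAlgebra 𝔸] [Nontrivial 𝔸] (w : WorldP)
    (hw : w.up = fun _ => Upstream.ofPrintedAllXP (withB7OfRecord X d L 𝔸) Y Z V W) (P : B12.RunParams) :
    Dag.B7_main (leavesP w P) := by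
  intro _
  show (w.up P).b7
  rw [hw]
  exact b7_withB7OfRecord X Y Z V W d L hL 𝔸

end Literature.MathematicalPhysics.QuantumFieldTheory.Balaban1983to89.Node00

end
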